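import Summits.CriticalPhenomena.Ising3DConformalLimit.Theorems.AnomalousForcesInteractionGaussianLimitIsFreeInheritanceForm
import Summits.CriticalPhenomena.Ising3DConformalLimit.Theorems.AnomalousForcesInteractionGaussianLimitIsFreeGaussianCondExpSqLe
import Summits.CriticalPhenomena.Ising3DConformalLimit.Theorems.MarkovRigidityFieldRealisationMomentLimit
import HarnessLib

/-!
# Crux `GaussianLimitIsFree` (item stmt-CriticalPhenomena-2601), line `registered` (skeleton v12, lead c5):
# Markov inheritance = CONTINUITY OF EXPLAINED VARIANCE along the realising sequence — lower half proved,
# upper half isolated as the single stub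

THEOREM-ONLY file (`--supports stmt-CriticalPhenomena-2601`).  Skeleton v11 (lead c4) left ONE stub: the `L²`
decoupling inequality (D_ε) `|E[ω(w)ω(v)]| ≤ ‖E[ω(w) | 𝒜((∂B)^ε)]‖₂ ‖ω(v)‖₂` across the unit sphere for the
(hypothetical) GAUSSIAN limit law `μ` of `μ_δ = spinFieldLaw ν (box 3 ⌊δ⁻²⌋) δ (ρ δ) ⇀ μ`.  (D_ε) holds for
every `μ_δ`, `δ < ε` (`sphereDecoupling_approximants`), and the covariances `E_{μ_δ}[ω(f)ω(g)]` converge to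
`E_μ[ω(f)ω(g)]` (`tendsto_integral_eval_mul_eval`, from `tendsto_moment_spinFieldLaw` of item 11245); so the only
quantity whose behaviour as `δ → 0⁺` is at stake is the explained variance
`e_δ(w,ε) := ∫ (μ_δ[ω(w) | 𝒜((∂B)^ε)])² dμ_δ` against its continuum counterpart `e(w,ε)`.  This file proves:

* `sq_integral_mul_le_integral_condExp_sq_mul` — `(∫ X g)² ≤ (∫ E[X|m]²)(∫ g²)` for `m`-measurable `g ∈ L²`;
* `explainedVariance_lsc`, `stub_explainedVariance_lsc` — **lower semicontinuity, PROVED** (for every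
  region, every `w`, no Markov property): `e_δ ≤ η²` frequently ⇒ `e ≤ η²` (linear predictors, covariance
  convergence, then the Gaussian projection theorem `integral_condExp_eval_sq_le` landed by lead c3) — the
  microscopic collar can only predict the interior BETTER, in the limit, than the smeared collar field;
* `sphereDecoupling_of_usc` — **the upper half is exactly what (D) needs**: `lim sup_δ e_δ(w,ε) ≤ e(w,ε)`
  (filter form) gives (D_ε) for `μ` at `w` and every exterior `v`;
* `GaussianLimitIsFree_of_usc` (= `stub_crux_of_usc`) — **the crux BY NAME** from the upper-semicontinuity
  statement `stub_explainedVariance_usc` of skeleton v12 (the v11 hypotheses plus `1/2 < Δ`, the only case the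
  rigidity uses — at `Δ = 1/2` the crux holds outright), via `delta_eq_half_of_sphereDecoupling`.

So inheritance IS continuity of `δ ↦ e_δ(w,ε)` at `0⁺`; the lower half is a theorem, the upper half — "the
`ε δ⁻³` collar spins do not out-predict the smeared collar field on `ω(w)`, asymptotically" — is the registered
stub, TRUE iff the crux is (vacuous unless the nearest-neighbour model has a Gaussian limit with `Δ ∈ (1/2,3/4]`,
then false by `not_sphereDecoupling_of_ne_half`).  Reflection positivity does not give the upper half: for
half-spaces `‖E_δ[F | plane]‖₂² = E_δ[F·θF]` (Markov + RP) makes `e_δ` CONVERGE, to the OS pairing, which for a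
generalised free field is the `dρ_Δ(m)`-average of the massive free fields' explained variances `≥ e`.

References: Yu. A. Rozanov, *Markov Random Fields* (1982), Ch. 2 §1.1, §3.1; J. Glimm, A. Jaffe, *Quantum
Physics* (1987) §6.1; M. Aizenman, Current Developments in Mathematics 2020 (2021), §3, §11.
-/

noncomputable section

namespace Summit.CriticalPhenomena.Ising3DConformalLimit.Cruxes.GaussianLimitIsFree.Birth

open MeasureTheory Filter Set
open scoped BigOperators Topology SchwartzMap
open Literature.MathematicalPhysics.QuantumLattice
open Literature.Probability.LatticeModels
open Summit.CriticalPhenomena.Ising3DConformalLimit.Theses.AnomalousForcesInteraction (GaussianLimitIsFree)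
open Summit.CriticalPhenomena.Ising3DConformalLimit.MoebiusLimitExistsOnlyInteraction (wickPower)
open Literature.Barriers.CriticalPhenomena.ScaleNotMoebius (axisUnit)

/-! ### Two abstract lemmas -/

section Abstract

variable {Ω : Type*}

/-- **Explained variance dominates squared correlations with measurable predictors**: for `m ≤ mΩ`, a
finite measure `μ`, `X ∈ L²(μ)` and an `m`-measurable `g ∈ L²(μ)`,
`(∫ X g dμ)² ≤ (∫ E[X | m]² dμ) · ∫ g² dμ` (pull-out property `∫ X g = ∫ E[X|m] g` and Cauchy–Schwarz).
This is the inequality behind the LOWER semicontinuity of explained variance under convergence of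
covariances. [cite: Rozanov1982, Ch. 2 §3.1 (3.1)–(3.3)] -/
theorem sq_integral_mul_le_integral_condExp_sq_mul {m mΩ : MeasurableSpace Ω} {μ : Measure Ω}
    [IsFiniteMeasure μ] (hm : m ≤ mΩ) {X g : Ω → ℝ} (hX : MemLp X 2 μ) (hg : MemLp g 2 μ)
    (hgm : StronglyMeasurable[m] g) :
    (∫ ω, X ω * g ω ∂μ) ^ 2 ≤ (∫ ω, (μ[X | m]) ω ^ 2 ∂μ) * ∫ ω, g ω ^ 2 ∂μ := by
  have hXi : Integrable X μ := hX.integrable one_le_two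
  have hXg : Integrable (X * g) μ := hX.integrable_mul hg
  have h1 : ∫ ω, X ω * g ω ∂μ = ∫ ω, (μ[X * g | m]) ω ∂μ := (integral_condExp hm).symm
  have h2 : μ[X * g | m] =ᵐ[μ] μ[X | m] * g := condExp_mul_of_stronglyMeasurable_right hgm hXg hXi
  have h3 : ∫ ω, X ω * g ω ∂μ = ∫ ω, (μ[X | m]) ω * g ω ∂μ := by
    rw [h1]
    refine integral_congr_ae ?_
    filter_upwards [h2] with ω hω
    rw [hω, Pi.mul_apply]
  have hcs := abs_integral_mul_le_sqrt_mul_sqrt (f := μ[X | m]) (g := g) (hX.condExp (m := m) one_le_two) hg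
  have h0 : 0 ≤ ∫ ω, (μ[X | m]) ω ^ 2 ∂μ := integral_nonneg fun _ => sq_nonneg _
  have h0' : 0 ≤ ∫ ω, g ω ^ 2 ∂μ := integral_nonneg fun _ => sq_nonneg _
  rw [h3]
  calc (∫ ω, (μ[X | m]) ω * g ω ∂μ) ^ 2 = |∫ ω, (μ[X | m]) ω * g ω ∂μ| ^ 2 := (sq_abs _).symm
    _ ≤ (Real.sqrt (∫ ω, (μ[X | m]) ω ^ 2 ∂μ) * Real.sqrt (∫ ω, g ω ^ 2 ∂μ)) ^ 2 :=
        pow_le_pow_left₀ (abs_nonneg _) hcs 2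
    _ = (∫ ω, (μ[X | m]) ω ^ 2 ∂μ) * ∫ ω, g ω ^ 2 ∂μ := by
        rw [mul_pow, Real.sq_sqrt h0, Real.sq_sqrt h0']

/-- **Passing a decoupling inequality to the limit needs only an upper bound on the middle factor**: if
`|a i| ≤ √(e i) √(b i)` eventually along a non-trivial filter, `a i → a₀`, `b i → b₀`, and for every `η > 0`
eventually `e i ≤ e₀ + η` (`lim sup e ≤ e₀`), then `|a₀| ≤ √e₀ √b₀`. [folklore] -/
theorem abs_le_sqrt_mul_sqrt_of_tendsto {ι : Type*} {l : Filter ι} [l.NeBot] {a b e : ι → ℝ}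
    {a₀ b₀ e₀ : ℝ} (hineq : ∀ᶠ i in l, |a i| ≤ Real.sqrt (e i) * Real.sqrt (b i))
    (ha : Tendsto a l (𝓝 a₀)) (hb : Tendsto b l (𝓝 b₀))
    (he : ∀ η : ℝ, 0 < η → ∀ᶠ i in l, e i ≤ e₀ + η) :
    |a₀| ≤ Real.sqrt e₀ * Real.sqrt b₀ := by
  -- for each `η > 0`: `|a₀| ≤ √(e₀ + η) √b₀`
  have hbound : ∀ η : ℝ, 0 < η → |a₀| ≤ Real.sqrt (e₀ + η) * Real.sqrt b₀ := by
    intro η hη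
    have hlim₁ : Tendsto (fun i => |a i|) l (𝓝 |a₀|) := (continuous_abs.tendsto _).comp ha
    have hlim₂ : Tendsto (fun i => Real.sqrt (e₀ + η) * Real.sqrt (b i)) l
        (𝓝 (Real.sqrt (e₀ + η) * Real.sqrt b₀)) :=
      ((Real.continuous_sqrt.tendsto _).comp hb).const_mul _
    refine le_of_tendsto_of_tendsto hlim₁ hlim₂ ?_
    filter_upwards [hineq, he η hη] with i hi hei
    exact hi.trans (mul_le_mul_of_nonneg_right (Real.sqrt_le_sqrt hei) (Real.sqrt_nonneg _))
  -- let `η → 0⁺`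
  have hcont : Tendsto (fun η : ℝ => Real.sqrt (e₀ + η) * Real.sqrt b₀) (𝓝[>] 0)
      (𝓝 (Real.sqrt (e₀ + 0) * Real.sqrt b₀)) := by
    have hc : Continuous fun η : ℝ => Real.sqrt (e₀ + η) * Real.sqrt b₀ := by fun_prop
    exact (hc.tendsto 0).mono_left nhdsWithin_le_nhds
  rw [add_zero] at hcont
  exact ge_of_tendsto hcont (eventually_mem_nhdsWithin.mono fun η (hη : 0 < η) => hbound η hη)

end Abstract

/-! ### Covariances converge along the realising sequence -/

section Field

open Summit.CriticalPhenomena.Ising3DConformalLimit.MarkovRigidityFieldRealisation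

variable {ρ : ℝ → ℝ} {Δ : ℝ} {S : CorrFamily 3}
  {μ : Measure (FieldConfig (EuclideanSpace ℝ (Fin 3)))}
  {ν : Measure (SpinConfig (Site 3))}

/-- The second moment in product form: `moment P 2 (f, g) = ∫ ω(f) ω(g) dP`. [folklore] -/
theorem moment_two_eq_integral_mul (P : Measure (FieldConfig (EuclideanSpace ℝ (Fin 3))))
    (f g : 𝓢(EuclideanSpace ℝ (Fin 3), ℝ)) :
    moment P 2 ![f, g] = ∫ ω, ω f * ω g ∂P := by
  unfold moment
  refine integral_congr_ae (Eventually.of_forall fun ω => ?_)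
  simp only [Fin.prod_univ_two, Matrix.cons_val_zero, Matrix.cons_val_one]

/-- **Covariances converge along the realising sequence.**  For a pointwise scaling limit `S` of
`criticalCorr 3` under `ρ` (non-degenerate, scale covariant with `0 < Δ < 3/2`), a law `ν` carrying the
critical plus correlations and a law `μ` with moment densities `S`:
`∫ ω(f)ω(g) d(spinFieldLaw ν (box 3 ⌊δ⁻²⌋) δ (ρ δ)) → ∫ ω(f)ω(g) dμ` as `δ → 0⁺`
(`tendsto_moment_spinFieldLaw` of item 11245 at `n = 2`, boxes `δ⌊δ⁻²⌋ → ∞`). [cite: GlimmJaffe1987, §6.1] -/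
theorem tendsto_integral_eval_mul_eval [IsProbabilityMeasure ν]
    (hlim : HasPointwiseScalingLimit (criticalCorr 3) ρ S) (hnd : IsNondegenerateTwoPoint S)
    (hsc : IsScaleCovariant Δ S) (hΔ0 : 0 < Δ) (hΔ : Δ < 3 / 2)
    (hν : ∀ B : Finset (Site 3), spinCorr ν B = plusCorr 3 (criticalBeta 3) 0 B)
    (hmom : ∀ (n : ℕ) (f : Fin n → 𝓢(EuclideanSpace ℝ (Fin 3), ℝ)),
      moment μ n f = ∫ x : Fin n → EuclideanSpace ℝ (Fin 3), S n x * ∏ i, f i (x i))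
    (f g : 𝓢(EuclideanSpace ℝ (Fin 3), ℝ)) :
    Tendsto (fun δ : ℝ => ∫ ω, ω f * ω g ∂(spinFieldLaw ν (box 3 ⌊δ⁻¹ ^ 2⌋₊) δ (ρ δ)))
      (𝓝[>] (0 : ℝ)) (𝓝 (∫ ω, ω f * ω g ∂μ)) := by
  have h := tendsto_moment_spinFieldLaw (L := fun δ : ℝ => ⌊δ⁻¹ ^ 2⌋₊) hlim hnd hsc hΔ0 hΔ hν
    tendsto_mesh_mul_boxSide ![f, g]
  have hlimval : (∫ x : Fin 2 → EuclideanSpace ℝ (Fin 3), (∏ i, (![f, g] i) (x i)) * S 2 x) =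
      ∫ ω, ω f * ω g ∂μ := by
    rw [← moment_two_eq_integral_mul μ f g, hmom 2 ![f, g]]
    exact integral_congr_ae (Eventually.of_forall fun x => mul_comm _ _)
  rw [hlimval] at h
  refine h.congr' (Eventually.of_forall fun δ => ?_)
  exact moment_two_eq_integral_mul _ f g

/-! ### Lower semicontinuity of explained variance (proved) -/

/-- On every lattice law the explained variance of `ω(w)` by `𝒜(U)` dominates the squared correlation of
`ω(w)` with each `ω(f)`, `supp f ⊆ U`: `(∫ ω(w)ω(f))² ≤ (∫ E[ω(w) | 𝒜(U)]²) ∫ ω(f)²`.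
[cite: Rozanov1982, Ch. 2 §3.1 (3.1)–(3.3)] -/
theorem sq_integral_le_explainedVariance_spinFieldLaw (ν : Measure (SpinConfig (Site 3)))
    [IsProbabilityMeasure ν] (Λ : Finset (Site 3)) (δ r : ℝ) {U : Set (EuclideanSpace ℝ (Fin 3))}
    (w f : 𝓢(EuclideanSpace ℝ (Fin 3), ℝ)) (hf : tsupport ⇑f ⊆ U) :
    (∫ ω, ω w * ω f ∂(spinFieldLaw ν Λ δ r)) ^ 2 ≤
      (∫ ω, ((spinFieldLaw ν Λ δ r)[(fun ω : FieldConfig (EuclideanSpace ℝ (Fin 3)) => ω w) |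
          fieldSigma U]) ω ^ 2 ∂(spinFieldLaw ν Λ δ r)) *
        ∫ ω, (ω f) ^ 2 ∂(spinFieldLaw ν Λ δ r) :=
  sq_integral_mul_le_integral_condExp_sq_mul (X := fun ω : FieldConfig (EuclideanSpace ℝ (Fin 3)) => ω w)
    (g := fun ω : FieldConfig (EuclideanSpace ℝ (Fin 3)) => ω f) (fieldSigma_le U)
    (memLp_two_eval_spinFieldLaw ν Λ δ r w) (memLp_two_eval_spinFieldLaw ν Λ δ r f)
    (measurable_eval_fieldSigma hf).stronglyMeasurable

/-- `a² ≤ η² c` with `η ≥ 0` gives `|a| ≤ η √c`. [folklore] -/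
theorem abs_le_mul_sqrt_of_sq_le {a η c : ℝ} (hη : 0 ≤ η) (h : a ^ 2 ≤ η ^ 2 * c) :
    |a| ≤ η * Real.sqrt c := by
  have h1 : Real.sqrt (a ^ 2) ≤ Real.sqrt (η ^ 2 * c) := Real.sqrt_le_sqrt h
  rwa [Real.sqrt_sq_eq_abs, Real.sqrt_mul (sq_nonneg η), Real.sqrt_sq hη] at h1

/-- **Lower semicontinuity of explained variance along the realising sequence (the proved half of Markov
inheritance).**  `S` a pointwise scaling limit of `criticalCorr 3` under `ρ` (non-degenerate, scale covariant,
`0 < Δ < 3/2`), `ν` carrying the critical plus correlations, `μ` a centred GAUSSIAN probability law with moment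
densities `S`, `μ_δ = spinFieldLaw ν (box 3 ⌊δ⁻²⌋) δ (ρ δ)`: for every region `U`, test function `w` and
`η ≥ 0`, if `∫ (μ_δ[ω(w) | 𝒜(U)])² dμ_δ ≤ η²` FREQUENTLY as `δ → 0⁺` then `∫ (μ[ω(w) | 𝒜(U)])² dμ ≤ η²`
(squared correlations with `ω(f)`, `supp f ⊆ U`, pass to the limit; then `integral_condExp_eval_sq_le`).
[cite: Rozanov1982, Ch. 2 §3.1 (3.1)–(3.3)] -/
theorem explainedVariance_lsc [IsProbabilityMeasure ν] [IsProbabilityMeasure μ]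
    (hlim : HasPointwiseScalingLimit (criticalCorr 3) ρ S) (hnd : IsNondegenerateTwoPoint S)
    (hsc : IsScaleCovariant Δ S) (hΔ0 : 0 < Δ) (hΔ : Δ < 3 / 2)
    (hν : ∀ B : Finset (Site 3), spinCorr ν B = plusCorr 3 (criticalBeta 3) 0 B)
    (hmom : ∀ (n : ℕ) (f : Fin n → 𝓢(EuclideanSpace ℝ (Fin 3), ℝ)),
      moment μ n f = ∫ x : Fin n → EuclideanSpace ℝ (Fin 3), S n x * ∏ i, f i (x i))
    (hG : IsGaussianField μ) (U : Set (EuclideanSpace ℝ (Fin 3)))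
    (w : 𝓢(EuclideanSpace ℝ (Fin 3), ℝ)) {η : ℝ} (hη : 0 ≤ η)
    (hfreq : ∃ᶠ δ in 𝓝[>] (0 : ℝ),
      ∫ ω, ((spinFieldLaw ν (box 3 ⌊δ⁻¹ ^ 2⌋₊) δ (ρ δ))[
          (fun ω : FieldConfig (EuclideanSpace ℝ (Fin 3)) => ω w) | fieldSigma U]) ω ^ 2
        ∂(spinFieldLaw ν (box 3 ⌊δ⁻¹ ^ 2⌋₊) δ (ρ δ)) ≤ η ^ 2) :
    ∫ ω, (μ[(fun ω : FieldConfig (EuclideanSpace ℝ (Fin 3)) => ω w) | fieldSigma U]) ω ^ 2 ∂μ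
      ≤ η ^ 2 := by
  refine stub_gaussian_condExp_sq_le μ hG U w η hη (fun f hf => ?_) _ le_rfl
  -- frequently along the sequence: `(∫ ω(w)ω(f) dμ_δ)² ≤ η² ∫ ω(f)ω(f) dμ_δ`
  have hfreq' : ∃ᶠ δ in 𝓝[>] (0 : ℝ),
      (∫ ω, ω w * ω f ∂(spinFieldLaw ν (box 3 ⌊δ⁻¹ ^ 2⌋₊) δ (ρ δ))) ^ 2 ≤
        η ^ 2 * ∫ ω, ω f * ω f ∂(spinFieldLaw ν (box 3 ⌊δ⁻¹ ^ 2⌋₊) δ (ρ δ)) := by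
    refine hfreq.mono fun δ hδ => ?_
    have hlat := sq_integral_le_explainedVariance_spinFieldLaw ν (box 3 ⌊δ⁻¹ ^ 2⌋₊) δ (ρ δ) w f hf
    have hsq : ∫ ω, (ω f) ^ 2 ∂(spinFieldLaw ν (box 3 ⌊δ⁻¹ ^ 2⌋₊) δ (ρ δ)) =
        ∫ ω, ω f * ω f ∂(spinFieldLaw ν (box 3 ⌊δ⁻¹ ^ 2⌋₊) δ (ρ δ)) :=
      integral_congr_ae (Eventually.of_forall fun ω => pow_two _)
    have hc : 0 ≤ ∫ ω, ω f * ω f ∂(spinFieldLaw ν (box 3 ⌊δ⁻¹ ^ 2⌋₊) δ (ρ δ)) :=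
      integral_nonneg fun ω => mul_self_nonneg _
    rw [hsq] at hlat
    exact hlat.trans (mul_le_mul_of_nonneg_right hδ hc)
  -- covariances converge
  have ha := tendsto_integral_eval_mul_eval hlim hnd hsc hΔ0 hΔ hν hmom w f
  have hc := tendsto_integral_eval_mul_eval hlim hnd hsc hΔ0 hΔ hν hmom f f
  -- the inequality is closed
  have hmem : (∫ ω, ω w * ω f ∂μ) ^ 2 ≤ η ^ 2 * ∫ ω, ω f * ω f ∂μ := by
    have hclosed : IsClosed {p : ℝ × ℝ | p.1 ^ 2 ≤ η ^ 2 * p.2} :=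
      isClosed_le (by fun_prop) (by fun_prop)
    exact hclosed.mem_of_frequently_of_tendsto hfreq' (ha.prodMk_nhds hc)
  have hsqμ : ∫ ω, (ω f) ^ 2 ∂μ = ∫ ω, ω f * ω f ∂μ :=
    integral_congr_ae (Eventually.of_forall fun ω => pow_two _)
  rw [hsqμ]
  exact abs_le_mul_sqrt_of_sq_le hη hmem

/-! ### The upper half is exactly what (D) needs -/

/-- **(D_ε) for the limit law from upper semicontinuity of the explained variance**: in the setting of
`explainedVariance_lsc` with `ν` a Gibbs measure of the nearest-neighbour specification ((D_ε) holds for every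
`μ_δ`, `δ < ε`) and `ρ > 0` on `(0,1]`, if `lim sup_{δ→0⁺} ∫ (μ_δ[ω(w)|𝒜((∂B)^ε)])² dμ_δ ≤ ∫ (μ[ω(w)|𝒜((∂B)^ε)])² dμ`
(filter form) for a `w` supported in the open unit ball, then (D_ε) holds for `μ` at `w` and every `v`
supported off `B̄(0,1+ε)`. [cite: Rozanov1982, Ch. 2 §1.1 (1.1)–(1.3)] -/
theorem sphereDecoupling_of_usc [IsProbabilityMeasure ν] {β h : ℝ}
    (hνG : ν ∈ isingGibbsMeasures 3 β h) (hρ : ∀ δ ∈ Set.Ioc (0 : ℝ) 1, 0 < ρ δ)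
    (hlim : HasPointwiseScalingLimit (criticalCorr 3) ρ S) (hnd : IsNondegenerateTwoPoint S)
    (hsc : IsScaleCovariant Δ S) (hΔ0 : 0 < Δ) (hΔ : Δ < 3 / 2)
    (hν : ∀ B : Finset (Site 3), spinCorr ν B = plusCorr 3 (criticalBeta 3) 0 B)
    (hmom : ∀ (n : ℕ) (f : Fin n → 𝓢(EuclideanSpace ℝ (Fin 3), ℝ)),
      moment μ n f = ∫ x : Fin n → EuclideanSpace ℝ (Fin 3), S n x * ∏ i, f i (x i))
    {ε : ℝ} (hε : 0 < ε) {w v : 𝓢(EuclideanSpace ℝ (Fin 3), ℝ)}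
    (hw : tsupport ⇑w ⊆ Metric.ball (0 : EuclideanSpace ℝ (Fin 3)) 1)
    (hv : tsupport ⇑v ⊆ (Metric.closedBall (0 : EuclideanSpace ℝ (Fin 3)) (1 + ε))ᶜ)
    (husc : ∀ η : ℝ, 0 < η → ∀ᶠ δ in 𝓝[>] (0 : ℝ),
      ∫ ω, ((spinFieldLaw ν (box 3 ⌊δ⁻¹ ^ 2⌋₊) δ (ρ δ))[
          (fun ω : FieldConfig (EuclideanSpace ℝ (Fin 3)) => ω w) |
          fieldSigma (Metric.thickening ε (Metric.sphere (0 : EuclideanSpace ℝ (Fin 3)) 1))]) ω ^ 2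
        ∂(spinFieldLaw ν (box 3 ⌊δ⁻¹ ^ 2⌋₊) δ (ρ δ)) ≤
      (∫ ω, (μ[(fun ω : FieldConfig (EuclideanSpace ℝ (Fin 3)) => ω w) |
          fieldSigma (Metric.thickening ε (Metric.sphere (0 : EuclideanSpace ℝ (Fin 3)) 1))]) ω ^ 2 ∂μ)
        + η) :
    |∫ ω, ω w * ω v ∂μ| ≤
      Real.sqrt (∫ ω, (μ[(fun ω : FieldConfig (EuclideanSpace ℝ (Fin 3)) => ω w) |
          fieldSigma (Metric.thickening ε (Metric.sphere (0 : EuclideanSpace ℝ (Fin 3)) 1))]) ω ^ 2 ∂μ) *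
        Real.sqrt (∫ ω, (ω v) ^ 2 ∂μ) := by
  -- (D_ε) on the lattice, eventually (`0 < δ < min ε (1/2)`, `ρ δ > 0`)
  have hineq : ∀ᶠ δ in 𝓝[>] (0 : ℝ),
      |∫ ω, ω w * ω v ∂(spinFieldLaw ν (box 3 ⌊δ⁻¹ ^ 2⌋₊) δ (ρ δ))| ≤
        Real.sqrt (∫ ω, ((spinFieldLaw ν (box 3 ⌊δ⁻¹ ^ 2⌋₊) δ (ρ δ))[
            (fun ω : FieldConfig (EuclideanSpace ℝ (Fin 3)) => ω w) |
            fieldSigma (Metric.thickening ε (Metric.sphere (0 : EuclideanSpace ℝ (Fin 3)) 1))]) ω ^ 2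
          ∂(spinFieldLaw ν (box 3 ⌊δ⁻¹ ^ 2⌋₊) δ (ρ δ))) *
        Real.sqrt (∫ ω, (ω v) ^ 2 ∂(spinFieldLaw ν (box 3 ⌊δ⁻¹ ^ 2⌋₊) δ (ρ δ))) := by
    have hI : Set.Ioo (0 : ℝ) (min ε (1 / 2)) ∈ 𝓝[>] (0 : ℝ) :=
      Ioo_mem_nhdsGT (lt_min hε (by norm_num))
    filter_upwards [hI] with δ hδ
    have hδ0 : 0 < δ := hδ.1
    have hδε : δ < ε := lt_of_lt_of_le hδ.2 (min_le_left _ _)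
    have hδ2 : δ ≤ 1 / 2 := (lt_of_lt_of_le hδ.2 (min_le_right _ _)).le
    have hρδ : ρ δ ≠ 0 := (hρ δ ⟨hδ0, by linarith⟩).ne'
    exact sphereDecoupling_approximants hνG hδ0 hδ2 hρδ hδε hw hv
  have ha := tendsto_integral_eval_mul_eval hlim hnd hsc hΔ0 hΔ hν hmom w v
  have hb : Tendsto (fun δ : ℝ => ∫ ω, (ω v) ^ 2 ∂(spinFieldLaw ν (box 3 ⌊δ⁻¹ ^ 2⌋₊) δ (ρ δ)))
      (𝓝[>] (0 : ℝ)) (𝓝 (∫ ω, (ω v) ^ 2 ∂μ)) := by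
    have h := tendsto_integral_eval_mul_eval hlim hnd hsc hΔ0 hΔ hν hmom v v
    have e1 : ∀ P : Measure (FieldConfig (EuclideanSpace ℝ (Fin 3))),
        ∫ ω, (ω v) ^ 2 ∂P = ∫ ω, ω v * ω v ∂P :=
      fun P => integral_congr_ae (Eventually.of_forall fun ω => pow_two _)
    simp_rw [e1]
    exact h
  exact abs_le_sqrt_mul_sqrt_of_tendsto hineq ha hb husc

end Field

/-! ### Stub-shaped statements: the proved lower half, and the crux from the upper half -/

section Stub

open Summit.CriticalPhenomena.Ising3DConformalLimit.MarkovRigidityFieldRealisation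

/-- **Lower semicontinuity of explained variance under EXACTLY the hypotheses of the v11 inheritance stub
(PROVED)** — `explainedVariance_lsc` for `ρ, Δ, A, S, μ, ν` as in `stub_sphereDecoupling_inheritance`, every
region `U`, test function `w`, `η ≥ 0` (the window `Δ ∈ [1/2, 3/4]` of `dimension_window_and_eta` feeds the
covariance convergence).  Its converse for `U = (∂B)^ε`, `supp w ⊆ B(0,1)`, `Δ > 1/2` is the registered stub
`stub_explainedVariance_usc` of skeleton v12. [cite: Rozanov1982, Ch. 2 §3.1 (3.1)–(3.3)] -/
theorem stub_explainedVariance_lsc :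
    ∀ (ρ : ℝ → ℝ) (Δ A : ℝ) (S : Literature.Probability.LatticeModels.CorrFamily 3) (μ : MeasureTheory.Measure (Literature.MathematicalPhysics.QuantumLattice.FieldConfig (EuclideanSpace ℝ (Fin 3)))), (∀ δ ∈ Set.Ioc (0:ℝ) 1, 0 < ρ δ) → Literature.Probability.LatticeModels.HasPointwiseScalingLimit (Literature.Probability.LatticeModels.criticalCorr 3) ρ S → (∀ n z, z ∉ Literature.Probability.LatticeModels.NonCoincident 3 n → S n z = 0) → Literature.Probability.LatticeModels.IsNondegenerateTwoPoint S → Literature.Probability.LatticeModels.IsTranslationInvariant S → Literature.Probability.LatticeModels.IsScaleCovariant Δ S → 0 < A → (∀ (n : ℕ) (x : Fin n → EuclideanSpace ℝ (Fin 3)), S n x = Real.sqrt A ^ n * Summit.CriticalPhenomena.Ising3DConformalLimit.MoebiusLimitExistsOnlyInteraction.wickPower Δ n x) → MeasureTheory.IsProbabilityMeasure μ → Literature.MathematicalPhysics.QuantumLattice.HasAllMoments μ → (∀ f : SchwartzMap (EuclideanSpace ℝ (Fin 3)) ℝ, MeasureTheory.Integrable (fun ω : Literature.MathematicalPhysics.QuantumLattice.FieldConfig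 (EuclideanSpace ℝ (Fin 3)) => Real.exp (ω f)) μ) → (∀ (n : ℕ) (f : Fin n → SchwartzMap (EuclideanSpace ℝ (Fin 3)) ℝ), Literature.MathematicalPhysics.QuantumLattice.moment μ n f = ∫ x : Fin n → EuclideanSpace ℝ (Fin 3), S n x * ∏ i, f i (x i)) → Literature.MathematicalPhysics.QuantumLattice.IsGaussianField μ → ∀ (ν : MeasureTheory.Measure (Literature.Probability.LatticeModels.SpinConfig (Literature.Probability.LatticeModels.Site 3))), ν ∈ Literature.Probability.LatticeModels.isingGibbsMeasures 3 (Literature.Probability.LatticeModels.criticalBeta 3) 0 → (∀ B : Finset (Literature.Probability.LatticeModels.Site 3), Literature.Probability.LatticeModels.spinCorr ν B = Literature.Probability.LatticeModels.plusCorr 3 (Literature.Probability.LatticeModels.criticalBeta 3) 0 B) → Literature.MathematicalPhysics.QuantumLattice.TendstoInLaw (fun δ : ℝ => Literature.MathematicalPhysics.QuantumLattice.spinFieldLaw ν (Literature.Probability.LatticeModels.box 3 ⌊δ⁻¹ ^ 2⌋₊) δ (ρ δ)) (nhdsWithin (0 : ℝ) (Set.Ioi 0)) μ → ∀ (U : Set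 (EuclideanSpace ℝ (Fin 3))) (w : SchwartzMap (EuclideanSpace ℝ (Fin 3)) ℝ) (η : ℝ), 0 ≤ η → Filter.Frequently (fun δ : ℝ => ∫ ω, (MeasureTheory.condExp (Literature.MathematicalPhysics.QuantumLattice.fieldSigma U) (Literature.MathematicalPhysics.QuantumLattice.spinFieldLaw ν (Literature.Probability.LatticeModels.box 3 ⌊δ⁻¹ ^ 2⌋₊) δ (ρ δ)) (fun ω : Literature.MathematicalPhysics.QuantumLattice.FieldConfig (EuclideanSpace ℝ (Fin 3)) => ω w)) ω ^ 2 ∂(Literature.MathematicalPhysics.QuantumLattice.spinFieldLaw ν (Literature.Probability.LatticeModels.box 3 ⌊δ⁻¹ ^ 2⌋₊) δ (ρ δ)) ≤ η ^ 2) (nhdsWithin (0 : ℝ) (Set.Ioi 0)) → ∫ ω, (MeasureTheory.condExp (Literature.MathematicalPhysics.QuantumLattice.fieldSigma U) μ (fun ω : Literature.MathematicalPhysics.QuantumLattice.FieldConfig (EuclideanSpace ℝ (Fin 3)) => ω w)) ω ^ 2 ∂μ ≤ η ^ 2 := by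
  intro ρ Δ A S μ hρ hlim _hzero hnd _htr hsc _hA _hS hμP _hall _hexp hmom hG ν hνG hν _hlaw U w η hη
    hfreq
  haveI := hμP
  haveI : IsProbabilityMeasure ν := ((mem_isingGibbsMeasures_iff 3 _ 0 ν).1 hνG).isProbabilityMeasure
  obtain ⟨⟨hlo, hhi⟩, -⟩ := GaussianLimitNotScreenedNegative.dimension_window_and_eta hρ hlim hnd hsc
  exact explainedVariance_lsc hlim hnd hsc (by linarith) (by linarith) hν hmom hG U w hη hfreq

open Summit.CriticalPhenomena.Ising3DConformalLimit.MoebiusLimitExistsNegative in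
open Classical in
/-- **The crux `GaussianLimitIsFree` BY NAME from upper semicontinuity of the explained variance along the
realising sequence** (the single stub `stub_explainedVariance_usc` of skeleton v12 verbatim as hypothesis):
normalise `S`, identify it with `(√A)ⁿ·W_{Δ'}`, `Δ' ∈ [1/2, 3/4]` (`gaussian_normalised_eq_gff`); if `Δ' = 1/2`
done; else realise `S` (`exists_plusMeasure_holds`, `exists_limitLaw` and its moments), Gaussianity
(`stub_newmanGaussianity`), (D_ε) for `μ` from the hypothesis (`sphereDecoupling_of_usc`), and
`delta_eq_half_of_sphereDecoupling`. [cite: GlimmJaffe1987, §6.1] -/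
theorem GaussianLimitIsFree_of_usc
    (hUSC : ∀ (ρ : ℝ → ℝ) (Δ A : ℝ) (S : Literature.Probability.LatticeModels.CorrFamily 3) (μ : MeasureTheory.Measure (Literature.MathematicalPhysics.QuantumLattice.FieldConfig (EuclideanSpace ℝ (Fin 3)))), (∀ δ ∈ Set.Ioc (0:ℝ) 1, 0 < ρ δ) → Literature.Probability.LatticeModels.HasPointwiseScalingLimit (Literature.Probability.LatticeModels.criticalCorr 3) ρ S → (∀ n z, z ∉ Literature.Probability.LatticeModels.NonCoincident 3 n → S n z = 0) → Literature.Probability.LatticeModels.IsNondegenerateTwoPoint S → Literature.Probability.LatticeModels.IsTranslationInvariant S → Literature.Probability.LatticeModels.IsScaleCovariant Δ S → 1 / 2 < Δ → 0 < A → (∀ (n : ℕ) (x : Fin n → EuclideanSpace ℝ (Fin 3)), S n x = Real.sqrt A ^ n * Summit.CriticalPhenomena.Ising3DConformalLimit.MoebiusLimitExistsOnlyInteraction.wickPower Δ n x) → MeasureTheory.IsProbabilityMeasure μ → Literature.MathematicalPhysics.QuantumLattice.HasAllMoments μ → (∀ f : SchwartzMap (EuclideanSpace ℝ (Fin 3))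 ℝ, MeasureTheory.Integrable (fun ω : Literature.MathematicalPhysics.QuantumLattice.FieldConfig (EuclideanSpace ℝ (Fin 3)) => Real.exp (ω f)) μ) → (∀ (n : ℕ) (f : Fin n → SchwartzMap (EuclideanSpace ℝ (Fin 3)) ℝ), Literature.MathematicalPhysics.QuantumLattice.moment μ n f = ∫ x : Fin n → EuclideanSpace ℝ (Fin 3), S n x * ∏ i, f i (x i)) → Literature.MathematicalPhysics.QuantumLattice.IsGaussianField μ → ∀ (ν : MeasureTheory.Measure (Literature.Probability.LatticeModels.SpinConfig (Literature.Probability.LatticeModels.Site 3))), ν ∈ Literature.Probability.LatticeModels.isingGibbsMeasures 3 (Literature.Probability.LatticeModels.criticalBeta 3) 0 → (∀ B : Finset (Literature.Probability.LatticeModels.Site 3), Literature.Probability.LatticeModels.spinCorr ν B = Literature.Probability.LatticeModels.plusCorr 3 (Literature.Probability.LatticeModels.criticalBeta 3) 0 B) → Literature.MathematicalPhysics.QuantumLattice.TendstoInLaw (fun δ : ℝ => Literature.MathematicalPhysics.QuantumLattice.spinFieldLaw ν (Literature.Probability.LatticeModels.box 3 ⌊δ⁻¹ ^ 2⌋₊)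 δ (ρ δ)) (nhdsWithin (0 : ℝ) (Set.Ioi 0)) μ → ∀ (ε : ℝ), 0 < ε → ∀ (w : SchwartzMap (EuclideanSpace ℝ (Fin 3)) ℝ), tsupport ⇑w ⊆ Metric.ball (0 : EuclideanSpace ℝ (Fin 3)) 1 → ∀ (η : ℝ), 0 < η → Filter.Eventually (fun δ : ℝ => ∫ ω, (MeasureTheory.condExp (Literature.MathematicalPhysics.QuantumLattice.fieldSigma (Metric.thickening ε (Metric.sphere (0 : EuclideanSpace ℝ (Fin 3)) 1))) (Literature.MathematicalPhysics.QuantumLattice.spinFieldLaw ν (Literature.Probability.LatticeModels.box 3 ⌊δ⁻¹ ^ 2⌋₊) δ (ρ δ)) (fun ω : Literature.MathematicalPhysics.QuantumLattice.FieldConfig (EuclideanSpace ℝ (Fin 3)) => ω w)) ω ^ 2 ∂(Literature.MathematicalPhysics.QuantumLattice.spinFieldLaw ν (Literature.Probability.LatticeModels.box 3 ⌊δ⁻¹ ^ 2⌋₊) δ (ρ δ)) ≤ (∫ ω, (MeasureTheory.condExp (Literature.MathematicalPhysics.QuantumLattice.fieldSigma (Metric.thickening ε (Metric.sphere (0 :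 EuclideanSpace ℝ (Fin 3)) 1))) μ (fun ω : Literature.MathematicalPhysics.QuantumLattice.FieldConfig (EuclideanSpace ℝ (Fin 3)) => ω w)) ω ^ 2 ∂μ) + η) (nhdsWithin (0 : ℝ) (Set.Ioi 0))) :
    GaussianLimitIsFree := by
  intro ρ Δ S hρ hlim hnd htr hsc hU4
  -- Step 0: normalise `S` off the non-coincident configurations.
  set S' : CorrFamily 3 := fun n x => if x ∈ NonCoincident 3 n then S n x else 0 with hS'
  have hlim' : HasPointwiseScalingLimit (criticalCorr 3) ρ S' := normalised_hasLimit hlim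
  have hnd' : IsNondegenerateTwoPoint S' := normalised_nondeg hnd
  have htr' : IsTranslationInvariant S' := normalised_translation htr
  have hsc' : IsScaleCovariant Δ S' := normalised_scale hsc
  have hU4' : ¬ HasNontrivialU4 S' := fun h => hU4 (hasNontrivialU4_normalised_iff.1 h)
  have hzero' : ∀ n z, z ∉ NonCoincident 3 n → S' n z = 0 := fun n z hz => if_neg hz
  have hU' : ∀ z ∈ NonCoincident 3 4, limitConnectedFour S' z = 0 := by
    intro z hz
    by_contra h
    exact hU4' ⟨z, hz, h⟩
  -- Step 1: `S' = (√A)ⁿ · W_{Δ'}`, `Δ' ∈ [1/2, 3/4]`, `Δ' = Δ`.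
  obtain ⟨Δ', hΔ'win, hscΔ', hgff⟩ :=
    Summit.CriticalPhenomena.Ising3DConformalLimit.PerfectScreeningGaussianLimitIsCoulomb.gaussian_normalised_eq_gff
      hρ hlim' hzero' hnd' hU'
  set A : ℝ := S' 2 ![0, axisUnit] with hA
  have hApos : 0 < A := hnd' _ (zero_unitVec_mem_nonCoincident (t := (1 : ℝ)) one_ne_zero)
  have hΔ : Δ = Δ' := delta_eq_of_isScaleCovariant' hnd' hsc' hscΔ'
  have hΔ'le : Δ' ≤ 1 := hΔ'win.2.trans (by norm_num)
  have hΔ0 : 0 < Δ' := by linarith [hΔ'win.1]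
  have hΔ32 : Δ' < 3 / 2 := by linarith [hΔ'win.2]
  rw [hΔ]
  -- The free case needs nothing.
  by_cases hhalf : Δ' = 1 / 2
  · exact hhalf
  have hlt : 1 / 2 < Δ' := lt_of_le_of_ne hΔ'win.1 (Ne.symm hhalf)
  -- Step 2: the realising sequence — critical plus DLR state, boxes `⌊δ⁻²⌋`, Minlos limit law.
  obtain ⟨ν, hνG, -, hν⟩ := exists_plusMeasure_holds (d := 3) (β := criticalBeta 3) (h := 0)
    (criticalBeta_nonneg 3)
  haveI : IsProbabilityMeasure ν := ((mem_isingGibbsMeasures_iff 3 _ 0 ν).1 hνG).isProbabilityMeasure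
  have hL := tendsto_mesh_mul_boxSide
  obtain ⟨μ, hμP, -, hlaw⟩ :=
    exists_limitLaw (L := fun δ : ℝ => ⌊δ⁻¹ ^ 2⌋₊) hlim' hnd' hscΔ' hΔ0 hΔ32 hν hL
  haveI := hμP
  have hμall : HasAllMoments μ := hasAllMoments_limitLaw hlim' hnd' hscΔ' hΔ0 hΔ32 hν hL hlaw
  have hμexp : ∀ f : SchwartzMap (EuclideanSpace ℝ (Fin 3)) ℝ,
      Integrable (fun ω : FieldConfig (EuclideanSpace ℝ (Fin 3)) => Real.exp (ω f)) μ :=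
    fun f => integrable_exp_eval_limitLaw hlim' hnd' hscΔ' hΔ0 hΔ32 hν hL hlaw f
  have hμmom : ∀ (n : ℕ) (f : Fin n → SchwartzMap (EuclideanSpace ℝ (Fin 3)) ℝ),
      Literature.MathematicalPhysics.QuantumLattice.moment μ n f =
        ∫ x : Fin n → EuclideanSpace ℝ (Fin 3), S' n x * ∏ i, f i (x i) := by
    intro n f
    rw [moment_limitLaw_eq hlim' hnd' hscΔ' hΔ0 hΔ32 hν hL hlaw f]
    exact integral_congr_ae (Eventually.of_forall fun x => mul_comm _ _)
  have hμmomW : ∀ (n : ℕ) (f : Fin n → SchwartzMap (EuclideanSpace ℝ (Fin 3)) ℝ),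
      Literature.MathematicalPhysics.QuantumLattice.moment μ n f =
        ∫ x : Fin n → EuclideanSpace ℝ (Fin 3), (Real.sqrt A ^ n * wickPower Δ' n x) * ∏ i, f i (x i) := by
    intro n f
    rw [hμmom n f]
    refine integral_congr_ae (Eventually.of_forall fun x => ?_)
    simp only [hgff n x]
  -- Step 3: Gaussianity (Newman; tree theorem).
  have hG : Literature.MathematicalPhysics.QuantumLattice.IsGaussianField μ :=
    stub_newmanGaussianity Δ' A μ hApos hΔ'win.1 hΔ'le hμP hμall hμexp hμmomW
  -- Step 4: (D_ε) for `μ` from upper semicontinuity along THIS sequence, then rigidity.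
  have hD : ∀ ε : ℝ, 0 < ε → ∀ w v : SchwartzMap (EuclideanSpace ℝ (Fin 3)) ℝ,
      tsupport ⇑w ⊆ Metric.ball (0 : EuclideanSpace ℝ (Fin 3)) 1 →
      tsupport ⇑v ⊆ (Metric.closedBall (0 : EuclideanSpace ℝ (Fin 3)) (1 + ε))ᶜ →
      |∫ ω, ω w * ω v ∂μ| ≤
        Real.sqrt (∫ ω, (μ[(fun ω : FieldConfig (EuclideanSpace ℝ (Fin 3)) => ω w) |
            fieldSigma (Metric.thickening ε (Metric.sphere (0 : EuclideanSpace ℝ (Fin 3)) 1))]) ω ^ 2 ∂μ) *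
          Real.sqrt (∫ ω, (ω v) ^ 2 ∂μ) := by
    intro ε hε w v hw hv
    have husc := hUSC ρ Δ' A S' μ hρ hlim' hzero' hnd' htr' hscΔ' hlt hApos hgff hμP hμall hμexp hμmom hG
      ν hνG hν hlaw ε hε w hw
    exact sphereDecoupling_of_usc hνG hρ hlim' hnd' hscΔ' hΔ0 hΔ32 hν hμmom hε hw hv husc
  exact delta_eq_half_of_sphereDecoupling Δ' A μ hApos hΔ'win.1 hΔ'le hμP hG hμmomW 1 one_pos
    (fun ε hε _ w v hw hv => hD ε hε w v hw hv)

/-- **Registered form (sub-goal `stub_crux_of_usc` of crux stmt-CriticalPhenomena-2601, skeleton v12): the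
crux BY NAME from the upper-semicontinuity statement** — `GaussianLimitIsFree_of_usc` verbatim.
[cite: GlimmJaffe1987, §6.1] -/
theorem stub_crux_of_usc :
    (∀ (ρ : ℝ → ℝ) (Δ A : ℝ) (S : Literature.Probability.LatticeModels.CorrFamily 3) (μ : MeasureTheory.Measure (Literature.MathematicalPhysics.QuantumLattice.FieldConfig (EuclideanSpace ℝ (Fin 3)))), (∀ δ ∈ Set.Ioc (0:ℝ) 1, 0 < ρ δ) → Literature.Probability.LatticeModels.HasPointwiseScalingLimit (Literature.Probability.LatticeModels.criticalCorr 3) ρ S → (∀ n z, z ∉ Literature.Probability.LatticeModels.NonCoincident 3 n → S n z = 0) → Literature.Probability.LatticeModels.IsNondegenerateTwoPoint S → Literature.Probability.LatticeModels.IsTranslationInvariant S → Literature.Probability.LatticeModels.IsScaleCovariant Δ S → 1 / 2 < Δ → 0 < A → (∀ (n : ℕ) (x : Fin n → EuclideanSpace ℝ (Fin 3)), S n x = Real.sqrt A ^ n * Summit.CriticalPhenomena.Ising3DConformalLimit.MoebiusLimitExistsOnlyInteraction.wickPower Δ n x) → MeasureTheory.IsProbabilityMeasure μ → Literature.MathematicalPhysics.QuantumLattice.HasAllMoments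 μ → (∀ f : SchwartzMap (EuclideanSpace ℝ (Fin 3)) ℝ, MeasureTheory.Integrable (fun ω : Literature.MathematicalPhysics.QuantumLattice.FieldConfig (EuclideanSpace ℝ (Fin 3)) => Real.exp (ω f)) μ) → (∀ (n : ℕ) (f : Fin n → SchwartzMap (EuclideanSpace ℝ (Fin 3)) ℝ), Literature.MathematicalPhysics.QuantumLattice.moment μ n f = ∫ x : Fin n → EuclideanSpace ℝ (Fin 3), S n x * ∏ i, f i (x i)) → Literature.MathematicalPhysics.QuantumLattice.IsGaussianField μ → ∀ (ν : MeasureTheory.Measure (Literature.Probability.LatticeModels.SpinConfig (Literature.Probability.LatticeModels.Site 3))), ν ∈ Literature.Probability.LatticeModels.isingGibbsMeasures 3 (Literature.Probability.LatticeModels.criticalBeta 3) 0 → (∀ B : Finset (Literature.Probability.LatticeModels.Site 3), Literature.Probability.LatticeModels.spinCorr ν B = Literature.Probability.LatticeModels.plusCorr 3 (Literature.Probability.LatticeModels.criticalBeta 3) 0 B) → Literature.MathematicalPhysics.QuantumLattice.TendstoInLaw (fun δ : ℝ => Literature.MathematicalPhysics.QuantumLattice.spinFieldLaw ν (Literature.Probability.LatticeModels.box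 3 ⌊δ⁻¹ ^ 2⌋₊) δ (ρ δ)) (nhdsWithin (0 : ℝ) (Set.Ioi 0)) μ → ∀ (ε : ℝ), 0 < ε → ∀ (w : SchwartzMap (EuclideanSpace ℝ (Fin 3)) ℝ), tsupport ⇑w ⊆ Metric.ball (0 : EuclideanSpace ℝ (Fin 3)) 1 → ∀ (η : ℝ), 0 < η → Filter.Eventually (fun δ : ℝ => ∫ ω, (MeasureTheory.condExp (Literature.MathematicalPhysics.QuantumLattice.fieldSigma (Metric.thickening ε (Metric.sphere (0 : EuclideanSpace ℝ (Fin 3)) 1))) (Literature.MathematicalPhysics.QuantumLattice.spinFieldLaw ν (Literature.Probability.LatticeModels.box 3 ⌊δ⁻¹ ^ 2⌋₊) δ (ρ δ)) (fun ω : Literature.MathematicalPhysics.QuantumLattice.FieldConfig (EuclideanSpace ℝ (Fin 3)) => ω w)) ω ^ 2 ∂(Literature.MathematicalPhysics.QuantumLattice.spinFieldLaw ν (Literature.Probability.LatticeModels.box 3 ⌊δ⁻¹ ^ 2⌋₊) δ (ρ δ)) ≤ (∫ ω, (MeasureTheory.condExp (Literature.MathematicalPhysics.QuantumLattice.fieldSigma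 (Metric.thickening ε (Metric.sphere (0 : EuclideanSpace ℝ (Fin 3)) 1))) μ (fun ω : Literature.MathematicalPhysics.QuantumLattice.FieldConfig (EuclideanSpace ℝ (Fin 3)) => ω w)) ω ^ 2 ∂μ) + η) (nhdsWithin (0 : ℝ) (Set.Ioi 0))) → Summit.CriticalPhenomena.Ising3DConformalLimit.Theses.AnomalousForcesInteraction.GaussianLimitIsFree :=
  GaussianLimitIsFree_of_usc

end Stub

end Summit.CriticalPhenomena.Ising3DConformalLimit.Cruxes.GaussianLimitIsFree.Birth

end
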